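import Summits.BirchSwinnertonDyer.BirchSwinnertonDyer.Theorems.QuadraticBranchSignedControlPlusEtaNonsurjThetaFunctionalEquationNormCoordinateIdeal
import Summits.BirchSwinnertonDyer.BirchSwinnertonDyer.Theorems.QuadraticBranchSignedControlPlusEtaNonsurjThetaFunctionalEquationOneZero
import HarnessLib

/-!
# Route `QuadraticBranchSignedControl` (rung K8, cell `bsd-potss`), residual crux `PlusEtaMainConjectureNonsurj`
# (stmt-BirchSwinnertonDyer-19606): THE FUNCTIONAL EQUATION ON THE QUADRATIC BRANCH, XXVIII — ZEROS IN THE NORM COORDINATE: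
# `Z(t) = t + t^ι = S(t)²` is a SQUARE in `ℤ_p`; **`L(t) = 0 ⟺ (t = 0 ∧ ord_T L > 0) ∨ H(t + t^ι) = 0`**; a `ℤ_p`-rational zero pair of `L`
# exists over a root `z₀` of `H` only if `z₀` is a square — **the 19601 shape `u·T^r(T − c₁)(T − c₂)` forces `c₁ + c₂ = −c₁c₂ ∈ (ℤ_p)²`**
# (seat `bsd-potss-k8eta-c2` g30; kernel, class-wide, fact-free)

WHY. Part XXVI identified the Weierstrass polynomial of every nonzero solution of `ι M = w(1+T)^e M` as `P = T^{r₀}(1+T)^k H(Z)`,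
`Z = T + ιT`, `H ∈ ℤ_p[Z]` distinguished of degree `k`; Part XV evaluates `Λ` at the points `t` of the open unit disc of `ℤ_p`
(`evalHom t`, partner `t^ι = (1+t)⁻¹ − 1`). THIS FILE reads the ZEROS of `L` in the disc through the norm coordinate: the value of `Z` at `t`
is the NORM `z(t) = t + t^ι = t²/(1+t)`, common to `t` and its partner, and it is the SQUARE `S(t)²` of the value of `S = T(1+T)^{−1/2}` — so
(§82) **every norm `t + t^ι` of a disc point is a square in `ℤ_p`**, of EVEN valuation; (§83) hence the 19601 `hshape` currency
`Lη = u·T^r·(T − c₁)(T − c₂)`, `c_i ∈ pℤ_p`, whose zeros are partners (Part XVII), FORCES `c₁ + c₂ = −c₁c₂` to be a square in `ℤ_p`: the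
Weierstrass quadratic `T² + aT + a` has a root in `pℤ_p` only if `−a` is a square (display P-30Z, k8eta-c2 g30: on 12 of the 19 level-4
rows with `λ = r₀ + 2` one has `v_5(a) = 1`, so NO `ℤ_5`-rational zero pair there — the two zeros are conjugate over a ramified quadratic
extension of `ℚ_5` and `hshape` with `c_i ∈ ℤ_5` is void on those rows); (§84) `P(t) = t^{r₀}(1+t)^k·H(z(t))` for any `t`, so for a datum
`L = a·P·U`: **`L(t) = 0 ⟺ (t = 0 ∧ r₀ > 0) ∨ H(t + t^ι) = 0`** — the zeros of `L` in the disc are read off the roots of `H` at the norms.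

MATHEMATICS. (§82) `(1+t)(1+t') = 1 ⟹ (1+t)(t+t') = t²`; `ev_t(Z) = t + t'`; `ev_t(S)² = ev_t(S²) = t + t'`; `x = s² ≠ 0 ⟹ v(x) = 2v(s)`.
(§83) `(1+c₁)(1+c₂) = 1` (Part XVII `partners_of_…`) ⟹ `c₁c₂ = −(c₁+c₂)`, `IsSquare (c₁+c₂)`. (§84) `(1+t)z = t² ⟹ Σ h_i t^{2i}(1+t)^{k−i} =
(1+t)^k Σ h_i z^i`; `ev_t ↑P = P(t)` (Part XIX); `1+t ∈ ℤ_pˣ`; `ℤ_p` a domain.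

WHAT. §82 `one_add_mul_add_partner`, `evalHom_trace`, `evalHom_sqrtZ_sq`, **`isSquare_add_partner`**, `valuation_eq_two_mul_of_sq`,
`even_valuation_of_isSquare`, `even_valuation_add_partner`; §83 `mul_eq_neg_add_of_partners`, **`isSquare_add_of_partners`**,
**`isSquare_add_of_shape_plus_row`** (19601 `hshape` ⟹ `IsSquare (c₁ + c₂)`, `c₁c₂ = −(c₁+c₂)`, even valuation); §84 `eval_normPoly_eq`,
**`eval_X_pow_mul_normPoly_eq`**, **`evalHom_eq_zero_iff_of_eq_X_pow_mul_normPoly`**, `evalHom_eq_zero_iff_norm_of_invol_eq`.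

HONEST FRAMING (cell `bsd-potss`; FULL-BSD rank ≤ 1 programme, HUMAN RULING D-0036/D-0074): TOOL THEOREMS ONLY — no definition, no named
fact, no `sorry`, axioms standard; nothing about (A), (C1⁺_η), C-cc-1 or `BSD(W,p)` of any pair is claimed; no stub of 19606 is proved;
crux and route OPEN; nothing booked. `--supports stmt-BirchSwinnertonDyer-19606`.

References: [Washington1997] §7.1, §13.2; [MazurTateTeitelbaum1986Invent] §I.17; [GreenbergLNM1716] §1 (pp. 67–68), §5 (p. 181);
[Pollack2003] Thm. 5.13. Tree: Parts XV (`evalHom_…`), XVII (`partners_of_shape_plus_row`), XIX (`evalHom_coe_polynomial`), XXIII–XXVI;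
Mathlib `PadicInt.valuation_mul`.
-/

set_option autoImplicit false
set_option linter.dupNamespace false
noncomputable section

open scoped Classical MatrixGroups ModularForm Topology

open PowerSeries CongruenceSubgroup WeierstrassCurve Literature.NumberTheory.EllipticCurves Literature.NumberTheory.EllipticCurves.ModularForms
open Literature.NumberTheory.EllipticCurves.IwasawaAlgebra
open Summit.BirchSwinnertonDyer.Rank1Residual.Additive

namespace Summit.BirchSwinnertonDyer.BirchSwinnertonDyer.Theorems.EtaThetaFunctionalEquation

variable {p : ℕ} [hp : Fact p.Prime] {r : ℤ_[p]} {S Z : IwasawaAlgebra p}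

/-! ## §82 The norm of a disc point is a square: `t + t^ι = t²/(1+t) = S(t)²` -/

/-- `(1+t)(1+t') = 1 ⟹ (1+t)·(t + t') = t²`: the norm `t + t'` of a partner pair is `t²/(1+t)`. [cite: MazurTateTeitelbaum1986Invent, §I.17] -/
theorem one_add_mul_add_partner {t t' : ℤ_[p]} (htt : (1 + t) * (1 + t') = 1) : (1 + t) * (t + t') = t ^ 2 := by
  linear_combination htt

/-- `ev_t(T + ιT) = t + t^ι`. [cite: MazurTateTeitelbaum1986Invent, §I.17] -/
theorem evalHom_trace (hZ : Z = X + invol p X) {t t' : ℤ_[p]} (ht : ‖t‖ < 1) (htt : (1 + t) * (1 + t') = 1) :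
    evalHom t ht Z = t + t' := by
  rw [hZ, map_add, evalHom_X_eq ht, invol_X, evalHom_invSubOne ht htt]

/-- **`S(t)² = t + t^ι`**: the norm of the pair `{t, t^ι}` is the square of the value of `S = T(1+T)^r` (`2r = −1`) at `t`. [folklore] -/
theorem evalHom_sqrtZ_sq (hr : 2 * r = -1) (hS : S = X * binomialSeries ℤ_[p] r) {t t' : ℤ_[p]} (ht : ‖t‖ < 1)
    (htt : (1 + t) * (1 + t') = 1) : evalHom t ht S ^ 2 = t + t' := by
  rw [← map_pow, hS, sqrtZ_sq_eq_X_add_invol_X hr, ← evalHom_trace rfl ht htt]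

/-- **THE NORM OF A DISC POINT IS A SQUARE IN `ℤ_p`** (`p` odd): `(1+t)(1+t') = 1`, `‖t‖ < 1` ⟹ `IsSquare (t + t')`.
[cite: MazurTateTeitelbaum1986Invent, §I.17] [cite: Washington1997, §13.2] -/
theorem isSquare_add_partner (hp2 : p ≠ 2) {t t' : ℤ_[p]} (ht : ‖t‖ < 1) (htt : (1 + t) * (1 + t') = 1) : IsSquare (t + t') := by
  obtain ⟨r, hr⟩ := exists_two_mul_eq_neg_one (p := p) hp2
  exact ⟨evalHom t ht (X * binomialSeries ℤ_[p] r), by rw [← sq, evalHom_sqrtZ_sq hr rfl ht htt]⟩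

/-- `x = s·s ≠ 0 ⟹ v(x) = 2·v(s)`. [folklore] -/
theorem valuation_eq_two_mul_of_sq {x s : ℤ_[p]} (hx : x ≠ 0) (h : x = s * s) : x.valuation = 2 * s.valuation := by
  have hs : s ≠ 0 := fun h0 ↦ hx (by rw [h, h0, mul_zero])
  rw [h, PadicInt.valuation_mul hs hs, two_mul]

/-- A nonzero square of `ℤ_p` has EVEN valuation. [folklore] -/
theorem even_valuation_of_isSquare {x : ℤ_[p]} (hx : x ≠ 0) (h : IsSquare x) : Even x.valuation := by
  obtain ⟨s, hs⟩ := h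
  exact ⟨s.valuation, by rw [valuation_eq_two_mul_of_sq hx hs, two_mul]⟩

/-- **The norm `t + t^ι ≠ 0` of a disc point has EVEN valuation** (`p` odd). [cite: Washington1997, §13.2] -/
theorem even_valuation_add_partner (hp2 : p ≠ 2) {t t' : ℤ_[p]} (ht : ‖t‖ < 1) (htt : (1 + t) * (1 + t') = 1) (h0 : t + t' ≠ 0) :
    Even (t + t').valuation :=
  even_valuation_of_isSquare h0 (isSquare_add_partner hp2 ht htt)

/-! ## §83 The 19601 shape forces a square: `(T − c₁)(T − c₂) = T² + aT + a` with `−a = c₁ + c₂ ∈ (ℤ_p)²` -/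

/-- Partners have `c₁c₂ = −(c₁ + c₂)`: `(T − c₁)(T − c₂) = T² + aT + a` with `a = c₁c₂ = −(c₁+c₂)`. [cite: MazurTateTeitelbaum1986Invent, §I.17] -/
theorem mul_eq_neg_add_of_partners {c₁ c₂ : ℤ_[p]} (h : (1 + c₁) * (1 + c₂) = 1) : c₁ * c₂ = -(c₁ + c₂) := by
  linear_combination h

/-- `p ∣ c ⟹ ‖c‖ < 1`. [folklore] -/
theorem norm_lt_one_of_natCast_dvd {c : ℤ_[p]} (hc : (p : ℤ_[p]) ∣ c) : ‖c‖ < 1 :=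
  (PadicInt.norm_lt_one_iff_dvd c).mpr hc

/-- **PARTNERS IN `pℤ_p` HAVE A SQUARE NORM**: `(1+c₁)(1+c₂) = 1`, `p ∣ c₁`, `p` odd ⟹ `IsSquare (c₁ + c₂)` and `c₁c₂ = −(c₁+c₂)`.
[cite: MazurTateTeitelbaum1986Invent, §I.17] [cite: Washington1997, §13.2] -/
theorem isSquare_add_of_partners (hp2 : p ≠ 2) {c₁ c₂ : ℤ_[p]} (hc₁ : (p : ℤ_[p]) ∣ c₁) (h : (1 + c₁) * (1 + c₂) = 1) :
    IsSquare (c₁ + c₂) ∧ c₁ * c₂ = -(c₁ + c₂) :=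
  ⟨isSquare_add_partner hp2 (norm_lt_one_of_natCast_dvd hc₁) h, mul_eq_neg_add_of_partners h⟩

section Row

variable {N : ℕ} [NeZero N] {f : CuspForm (Gamma0 N) 2}

/-- **AT A ROW (plus), THE 19601 `hshape` FORCES A SQUARE**: `V` globally minimal, good at `p ≥ 5`, `a_p(V) = 0`, `f` its newform, any `ϖ`,
every plus branch function of the shape `Lη = u·T^r·(T − c₁)(T − c₂)` (`u ∈ Λˣ`, `p ∣ c₁`, `p ∣ c₂`): **`c₁ + c₂` is a SQUARE in `ℤ_p`**,
`c₁c₂ = −(c₁ + c₂)` (the quadratic is `T² + aT + a`, `−a ∈ (ℤ_p)²`), and `v_p(c₁ + c₂)` is even if `c₁ + c₂ ≠ 0`. Contrapositively: a row whose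
reciprocal Weierstrass quadratic `T² + aT + a` has `v_p(a)` odd admits NO such shape with `c_i ∈ ℤ_p` (its two zeros are conjugate over a
ramified quadratic extension of `ℚ_p`). Hypothesis-free beyond the row data and the shape. [cite: GreenbergLNM1716, §5 (p. 181)]
[cite: MazurTateTeitelbaum1986Invent, §I.17] -/
theorem isSquare_add_of_shape_plus_row (hp5 : 5 ≤ p) (V : WeierstrassCurve ℚ) [V.IsElliptic] [V.IsGloballyMinimal]
    (hgood : V.HasGoodReductionAtPrime p) (hap : V.frobeniusTrace p = 0) (hf : IsNewformOf V f) (ϖ : ℚ) {Lη : IwasawaAlgebra p}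
    (hL : IsQuadraticBranchPlusLFunction f p ϖ Lη) {u : IwasawaAlgebra p} (hu : IsUnit u) {c₁ c₂ : ℤ_[p]}
    (hc₁ : (p : ℤ_[p]) ∣ c₁) (hc₂ : (p : ℤ_[p]) ∣ c₂) {r : ℕ}
    (hLs : Lη = u * PowerSeries.X ^ r * ((PowerSeries.X - PowerSeries.C c₁) * (PowerSeries.X - PowerSeries.C c₂))) :
    IsSquare (c₁ + c₂) ∧ c₁ * c₂ = -(c₁ + c₂) ∧ (c₁ + c₂ ≠ 0 → Even (c₁ + c₂).valuation) := by
  have hp2 : p ≠ 2 := by omega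
  have hcc := partners_of_shape_plus_row hp5 V hgood hap hf ϖ hL hu hc₁ hc₂ hLs
  obtain ⟨hsq, hmul⟩ := isSquare_add_of_partners hp2 hc₁ hcc
  exact ⟨hsq, hmul, fun h0 ↦ even_valuation_of_isSquare h0 hsq⟩

end Row

/-! ## §84 Zeros of `L` in the disc ⟷ roots of `H` at the norms -/

/-- **Evaluation of the norm polynomial**: `(1+t)·z = t²` ⟹ `Σ_{i≤k} h_i t^{2i}(1+t)^{k−i} = (1+t)^k·H(z)` (`k = deg H`; any `t, z`, no division).
[cite: Washington1997, §7.1] -/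
theorem eval_normPoly_eq (H : Polynomial ℤ_[p]) {t z : ℤ_[p]} (htz : (1 + t) * z = t ^ 2) :
    (∑ i ∈ Finset.range (H.natDegree + 1),
        Polynomial.C (H.coeff i) * Polynomial.X ^ (2 * i) * (1 + Polynomial.X) ^ (H.natDegree - i) : Polynomial ℤ_[p]).eval t =
      (1 + t) ^ H.natDegree * H.eval z := by
  rw [Polynomial.eval_finsetSum, Polynomial.eval_eq_sum_range' (Nat.lt_succ_self _) z, Finset.mul_sum]
  refine Finset.sum_congr rfl fun i hi ↦ ?_
  have hik : i ≤ H.natDegree := Nat.lt_succ_iff.mp (Finset.mem_range.mp hi)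
  obtain ⟨d, hd⟩ := Nat.exists_eq_add_of_le hik
  rw [Polynomial.eval_mul, Polynomial.eval_mul, Polynomial.eval_C, Polynomial.eval_pow, Polynomial.eval_X, Polynomial.eval_pow,
    Polynomial.eval_add, Polynomial.eval_one, Polynomial.eval_X, hd, Nat.add_sub_cancel_left, pow_mul, ← htz, mul_pow, pow_add]
  ring

/-- **`P(t) = t^{r₀}·(1+t)^k·H(z)`** for `P = T^{r₀}·normPoly H` and `(1+t)z = t²`. [cite: Washington1997, §7.1] -/
theorem eval_X_pow_mul_normPoly_eq (H : Polynomial ℤ_[p]) (r₀ : ℕ) {t z : ℤ_[p]} (htz : (1 + t) * z = t ^ 2) :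
    (Polynomial.X ^ r₀ * ∑ i ∈ Finset.range (H.natDegree + 1),
        Polynomial.C (H.coeff i) * Polynomial.X ^ (2 * i) * (1 + Polynomial.X) ^ (H.natDegree - i) : Polynomial ℤ_[p]).eval t =
      t ^ r₀ * (1 + t) ^ H.natDegree * H.eval z := by
  rw [Polynomial.eval_mul, Polynomial.eval_pow, Polynomial.eval_X, eval_normPoly_eq H htz, mul_assoc]

/-- **ZEROS IN THE DISC ⟷ ROOTS OF `H` AT THE NORMS.** For a datum `L = a·P·U` (`a ≠ 0`, `U ∈ Λˣ`) with `P = T^{r₀}·normPoly H` and a disc point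
`t` (`‖t‖ < 1`) with partner `t'`: **`L(t) = 0 ⟺ (t = 0 ∧ 0 < r₀) ∨ H(t + t') = 0`** (`1 + t ∈ ℤ_pˣ`, `U(t) ∈ ℤ_pˣ`, `ℤ_p` a domain).
[cite: Washington1997, §7.1] [cite: MazurTateTeitelbaum1986Invent, §I.17] -/
theorem evalHom_eq_zero_iff_of_eq_X_pow_mul_normPoly {H : Polynomial ℤ_[p]} {r₀ : ℕ} {P : Polynomial ℤ_[p]}
    (hP : P = Polynomial.X ^ r₀ * ∑ i ∈ Finset.range (H.natDegree + 1),
        Polynomial.C (H.coeff i) * Polynomial.X ^ (2 * i) * (1 + Polynomial.X) ^ (H.natDegree - i))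
    {a : ℤ_[p]} (ha : a ≠ 0) {U : IwasawaAlgebra p} (hU : IsUnit U) {L : IwasawaAlgebra p} (hL : L = C a * (P : IwasawaAlgebra p) * U)
    {t t' : ℤ_[p]} (ht : ‖t‖ < 1) (htt : (1 + t) * (1 + t') = 1) :
    evalHom t ht L = 0 ↔ (t = 0 ∧ 0 < r₀) ∨ H.eval (t + t') = 0 := by
  have hU' : IsUnit (evalHom t ht U) := hU.map _
  have h1t : IsUnit (1 + t) := IsUnit.of_mul_eq_one _ htt
  have hev : evalHom t ht L = a * (t ^ r₀ * (1 + t) ^ H.natDegree * H.eval (t + t')) * evalHom t ht U := by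
    rw [hL, map_mul, map_mul, evalHom_C_eq ht, evalHom_coe_polynomial ht, hP, eval_X_pow_mul_normPoly_eq H r₀ (one_add_mul_add_partner htt)]
  rw [hev, mul_eq_zero, mul_eq_zero, or_iff_left hU'.ne_zero, or_iff_right ha, mul_eq_zero, mul_eq_zero,
    or_iff_left (pow_ne_zero _ h1t.ne_zero)]
  rcases Nat.eq_zero_or_pos r₀ with hr | hr
  · subst hr
    rw [pow_zero]
    constructor
    · rintro (h | h)
      · exact absurd h one_ne_zero
      · exact Or.inr h
    · rintro (⟨-, h⟩ | h)
      · exact absurd h (lt_irrefl 0)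
      · exact Or.inr h
  · rw [pow_eq_zero_iff hr.ne']
    constructor
    · rintro (h | h)
      · exact Or.inl ⟨h, hr⟩
      · exact Or.inr h
    · rintro (⟨h, -⟩ | h)
      · exact Or.inl h
      · exact Or.inr h

/-- **ZEROS OF A SOLUTION OF THE FUNCTIONAL EQUATION, READ IN THE NORM COORDINATE**: `p` odd (`2r = −1`, `S`, `Z`), `M ≠ 0` with
`ι M = w(1+T)^e M`, ANY Weierstrass datum `M = p^m·P·U`; then with the distinguished `H ∈ ℤ_p[Z]` of Part XXVI (`P = T^{r₀}(1+T)^k H(Z)`,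
`r₀ = ord_T M`), for every disc point `t` with partner `t'`: **`M(t) = 0 ⟺ (t = 0 ∧ 0 < ord_T M) ∨ H(t + t') = 0`**; and the norm `t + t'` is a
SQUARE in `ℤ_p`. [cite: Washington1997, §7.1, §13.2] [cite: MazurTateTeitelbaum1986Invent, §I.17] [cite: GreenbergLNM1716, §1 (pp. 67–68)] -/
theorem evalHom_eq_zero_iff_norm_of_invol_eq (hr : 2 * r = -1) (hS : S = X * binomialSeries ℤ_[p] r) (hZ : Z = X + invol p X)
    {M : IwasawaAlgebra p} (hM0 : M ≠ 0) {w e : ℤ_[p]} (hFE : invol p M = C w * binomialSeries ℤ_[p] e * M)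
    {m : ℕ} {P : Polynomial ℤ_[p]} (hP : P.IsDistinguishedAt (IsLocalRing.maximalIdeal ℤ_[p])) {U : IwasawaAlgebra p} (hU : IsUnit U)
    (hMP : M = C ((p : ℤ_[p]) ^ m) * (P : IwasawaAlgebra p) * U) :
    ∃ H : Polynomial ℤ_[p], H.IsDistinguishedAt (IsLocalRing.maximalIdeal ℤ_[p]) ∧
      (P : IwasawaAlgebra p) = X ^ (PowerSeries.order M).toNat * (1 + X) ^ H.natDegree * PowerSeries.subst Z (H : IwasawaAlgebra p) ∧
      ∀ {t t' : ℤ_[p]} (ht : ‖t‖ < 1), (1 + t) * (1 + t') = 1 →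
        (evalHom t ht M = 0 ↔ (t = 0 ∧ 0 < (PowerSeries.order M).toNat) ∨ H.eval (t + t') = 0) ∧ IsSquare (t + t') := by
  obtain ⟨-, H, -, -, hH, -, -, hPeq, hPZ, -⟩ := weierstrass_eq_X_pow_mul_normPoly_of_invol_eq hr hS hZ hM0 hFE hP hU hMP
  have hpm : ((p : ℤ_[p]) ^ m) ≠ 0 := pow_ne_zero _ (Nat.cast_ne_zero.mpr hp.out.ne_zero)
  exact ⟨H, hH, hPZ, fun ht htt ↦ ⟨evalHom_eq_zero_iff_of_eq_X_pow_mul_normPoly hPeq hpm hU hMP ht htt,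
    isSquare_add_partner (ne_two_of_two_mul_eq_neg_one hr) ht htt⟩⟩

end Summit.BirchSwinnertonDyer.BirchSwinnertonDyer.Theorems.EtaThetaFunctionalEquation

end
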